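import Literature.Probability.Percolation.BKFinitary
import Literature.Probability.Percolation.SharpnessDCTProofs

/-!
# Crux `PercNonProliferation.FreeBoxPowerSaving` (stmt-CriticalPhenomena-4447), line
# `tightness-collapse-typical-kmax` — stub `stub_sizeSplitting`

Helper file for the checked skeleton of the crux `FreeBoxPowerSaving` (route
`PercNonProliferation`). Proves exactly the registered stub signature `stub_sizeSplitting`; lands
with `--supports stmt-CriticalPhenomena-4447`.

**Statement** (van den Berg–Kesten size splitting of the largest free-box piece; Hutchcroft,
PTRF 181 (2021), arXiv:2008.11197, Thm 2.3 with `k = 1`: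
`P(|K_max(Λ)| ≥ 3λ) ≤ P(|K_max(Λ)| ≥ λ)^{3⁰ + 1}`, here re-proved elementarily for the graph
induced on the box). For bond percolation on `ℤ³`, every `p`, every `n` and every real `s ≥ 1`,
`P_p(QG(n, 3s)) ≤ P_p(QG(n, s))²`, where `QG(n, t)` is the event that some vertex `u` of the free
box `B(n) = box 3 n` is joined INSIDE `B(n)` by open paths to at least `t` vertices of `B(n)`.

## The argument

* §1 (pure graph theory, any simple graph `H`; Hutchcroft 2021, Lemma 2.4 with `k = 1`, vertex
  form). **Splitting lemma**: a finite vertex set `P` on which `H` is connected through `P` (every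
  vertex of `P` is joined to a root `r ∈ P` by an `H`-path with all its vertices in `P`), with
  `|P| ≥ 3m - 2`, `m ≥ 1`, contains two such sets `P₁, P₂` with `|P₁|, |P₂| ≥ m` and
  `|P₁ ∩ P₂| ≤ 1`. It follows from the ROOTED statement (`exists_rooted_split`, strong induction
  on `P`): for `r ∈ P`, `1 ≤ m ≤ |P|` there are `Q ⊆ P` and `q ∈ Q` with `Q` connected through
  itself, `m ≤ |Q| ≤ 2m - 1`, and `(P \ Q) ∪ {q}` connected through itself and containing `r`.
  Step: if `|P| ≤ 2m - 1` take `Q = P`, `q = r`; otherwise pick `x ∈ P`, `x ≠ r`, and its BRANCH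
  `C` = the vertices joined to `x` inside `P \ {r}` (`exists_branch`: `r ∉ C ∋ x`, `C` is
  connected through itself, some `r' ∈ C` is adjacent to `r`, and `P \ C` is connected through
  itself from `r`); if `|C| ≥ m` recurse into `(C, r')`, else into `(P \ C, r)`, and hang the
  untouched part back onto `r`.
* §2 (percolation, any graph with countably many vertices, any finite vertex set `B`). The event
  `A_t = {∃ u ∈ B, |piece of u in B| ≥ t}` is increasing (`isUpperSet_openConnIn`) and finitary
  (`DCT16.determinedBy_openConnIn`: it only reads the pairs inside `B`). INCLUSION
  `A_{3s} ⊆ A_s □ A_s` for `s ≥ 1`: with `m = ⌈s⌉`, a piece `P` with `|P| ≥ 3s > 3m - 3` vertices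
  is connected through itself in the open graph; split it into `P₁, P₂` as in §1 and take the
  witnesses `K_i = {e ∈ ω | e` not a loop, both ends in `P_i}`: they are disjoint
  (`|P₁ ∩ P₂| ≤ 1`), contained in `ω`, and `K_i ∈ A_s` (under `K_i` every vertex of `P_i` is
  still joined inside `B` to all of `P_i`, and `|P_i| ≥ m ≥ s`). Then `bk_finitary` (the tree's
  BK inequality for finitary increasing events) gives `P(A_{3s}) ≤ P(A_s □ A_s) ≤ P(A_s)²`.
* §3 the registered stub: `B = box 3 n`, `G = zdGraph 3`.

No new definitions: the events are written out as set-builder expressions exactly as registered.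
-/

noncomputable section

open MeasureTheory Filter
open Literature.Probability.Percolation Literature.Probability.LatticeModels
open scoped Topology Classical

namespace Summit.CriticalPhenomena.PercolationContinuityZ3.FreeBoxPowerSavingLine

/-! ### §1 Splitting a connected finite vertex set into two halves sharing at most one vertex -/

section Splitting

variable {V : Type*} {H : SimpleGraph V}

/-- A path inside `A` from `x` only visits vertices that are themselves joined to `x` inside `A`
(same statement as the tree's `PathIn.restrict` for site configurations). [folklore] -/
theorem pathIn_restrict {A : Set V} {x c : V} (h : PathIn H A x c) :
    PathIn H {u | u ∈ A ∧ PathIn H A x u} x c := by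
  obtain ⟨hx, h⟩ := h
  induction h with
  | refl => exact PathIn.refl ⟨hx, PathIn.refl hx⟩
  | @tail b d hxb hbd ih =>
    have hb : PathIn H A x b := ⟨hx, hxb⟩
    exact ih.tail hbd.1 ⟨hbd.2, hb.tail hbd.1 hbd.2⟩

/-- Membership in the branch of `x` at the root `r`: the vertices of `P` joined to `x` by an
`H`-path avoiding `r`. [folklore] -/
theorem mem_branch_iff {P : Finset V} {r x y : V} :
    y ∈ P.filter (fun y => PathIn H (↑P \ {r}) x y) ↔ PathIn H (↑P \ {r}) x y := by
  simp only [Finset.mem_filter, and_iff_right_iff_imp]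
  exact fun h => h.right_mem.1

/-- The root is not in any branch. [folklore] -/
theorem root_notMem_branch {P : Finset V} {r x : V} :
    r ∉ P.filter (fun y => PathIn H (↑P \ {r}) x y) := fun h =>
  (mem_branch_iff.1 h).right_mem.2 rfl

/-- A branch is connected through itself from its base point. [folklore] -/
theorem pathIn_branch {P : Finset V} {r x y : V}
    (hy : y ∈ P.filter (fun y => PathIn H (↑P \ {r}) x y)) :
    PathIn H ↑(P.filter (fun y => PathIn H (↑P \ {r}) x y)) x y := by
  refine (pathIn_restrict (mem_branch_iff.1 hy)).mono ?_
  rintro u ⟨-, hu⟩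
  exact Finset.mem_coe.2 (mem_branch_iff.2 hu)

/-- **Branches at a root.** If `P` is connected through itself from `r` and `x ∈ P`, `x ≠ r`, the
branch `C` of `x` (vertices joined to `x` inside `P \ {r}`) satisfies: `C ⊆ P`, `r ∉ C`, `x ∈ C`,
some `r' ∈ C` is adjacent to `r` and `C` is connected through itself from `r'`, and the rest
`P \ C` is connected through itself from `r`. [folklore] -/
theorem exists_branch {P : Finset V} {r x : V} (hr : r ∈ P) (hP : ∀ a ∈ P, PathIn H ↑P r a)
    (hx : x ∈ P) (hxr : x ≠ r) :
    ∃ C ⊆ P, r ∉ C ∧ x ∈ C ∧ ∃ r' ∈ C, H.Adj r r' ∧ (∀ a ∈ C, PathIn H ↑C r' a) ∧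
      ∀ a ∈ P \ C, PathIn H ↑(P \ C) r a := by
  set C := P.filter (fun y => PathIn H (↑P \ {r}) x y) with hC
  have hrC : r ∉ C := root_notMem_branch
  have hxC : x ∈ C := mem_branch_iff.2 (PathIn.refl ⟨Finset.mem_coe.2 hx, hxr⟩)
  -- a neighbour of the root inside the branch: the first exit of a path `x ⟶ r` from `C`
  obtain ⟨r', hr'C, hrr'⟩ : ∃ r' ∈ C, H.Adj r r' := by
    obtain ⟨a, b, ha, hb, hbP, hab, -⟩ := (hP x hx).symm.exit (R := (↑C : Set V)) hxC hrC
    by_cases hbr : b = r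
    · subst hbr
      exact ⟨a, ha, hab.symm⟩
    · exact absurd (Finset.mem_coe.2 (mem_branch_iff.2 ((mem_branch_iff.1 ha).tail hab ⟨hbP, hbr⟩)))
        hb
  refine ⟨C, Finset.filter_subset _ _, hrC, hxC, r', hr'C, hrr', fun a ha =>
    (pathIn_branch hr'C).symm.trans (pathIn_branch ha), fun y hy => ?_⟩
  -- the rest is connected from `r`: after its last visit to `r`, a path `r ⟶ y` avoids `C`
  rw [Finset.mem_sdiff] at hy
  have hrPC : r ∈ (↑(P \ C) : Set V) := by simp [hr, hrC]
  rcases (hP y hy.1).last_exit_or (C := ({r} : Set V)) rfl with hyr | ⟨a, b, har, -, -, hab, hpath⟩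
  · rw [Set.mem_singleton_iff] at hyr
    subst hyr
    exact PathIn.refl hrPC
  · rw [Set.mem_singleton_iff] at har
    subst har
    have key : PathIn H ↑(P \ C) y b := by
      refine (pathIn_restrict hpath.symm).mono ?_
      rintro u ⟨hu, hyu⟩
      rw [Finset.coe_sdiff, Set.mem_sdiff]
      exact ⟨hu.1, fun huC => hy.2 (mem_branch_iff.2 ((mem_branch_iff.1 huC).trans hyu.symm))⟩
    exact (PathIn.of_adj hrPC key.symm.left_mem hab).trans key.symm

/-- **Rooted splitting.** If the finite set `P` is connected through itself from `r ∈ P` and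
`1 ≤ m ≤ |P|`, there are `Q ⊆ P` and `q ∈ Q` with `Q` connected through itself from `q`,
`m ≤ |Q| ≤ 2m - 1`, and `(P \ Q) ∪ {q}` connected through itself from `r` (for a tree: a vertex
`q` together with some of its pendant subtrees). [cite: Hutchcroft2021, Lemma 2.4] -/
theorem exists_rooted_split (P : Finset V) :
    ∀ (r : V) (m : ℕ), r ∈ P → (∀ a ∈ P, PathIn H ↑P r a) → 1 ≤ m → m ≤ P.card →
      ∃ Q ⊆ P, ∃ q ∈ Q, (∀ a ∈ Q, PathIn H ↑Q q a) ∧ m ≤ Q.card ∧ Q.card ≤ 2 * m - 1 ∧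
        ∀ a ∈ insert q (P \ Q), PathIn H ↑(insert q (P \ Q)) r a := by
  induction P using Finset.strongInduction with
  | H P ih =>
  intro r m hr hP hm hmP
  by_cases hsmall : P.card ≤ 2 * m - 1
  · -- the whole set is small enough: `Q = P`, `q = r`
    refine ⟨P, Finset.Subset.rfl, r, hr, hP, hmP, hsmall, fun a ha => ?_⟩
    obtain rfl : a = r := by simpa using ha
    exact PathIn.refl (by simp)
  push Not at hsmall
  obtain ⟨x, hx, hxr⟩ : ∃ x ∈ P, x ≠ r := by
    by_contra h
    push Not at h
    have : P.card ≤ 1 := Finset.card_le_one.2 fun a ha b hb => by rw [h a ha, h b hb]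
    omega
  obtain ⟨C, hCP, hrC, hxC, r', hr'C, hrr', hCconn, hcompl⟩ := exists_branch hr hP hx hxr
  by_cases hA : m ≤ C.card
  · -- Case A: the branch is large; split it and hang the rest of `P` onto `r`
    have hCss : C ⊂ P := Finset.ssubset_iff_subset_ne.2 ⟨hCP, fun h => hrC (h ▸ hr)⟩
    obtain ⟨Q, hQC, q, hqQ, hQconn, hmQ, hQm, hrest⟩ := ih C hCss r' m hr'C hCconn hm hA
    refine ⟨Q, hQC.trans hCP, q, hqQ, hQconn, hmQ, hQm, fun a ha => ?_⟩
    have hsub : insert q (C \ Q) ⊆ insert q (P \ Q) :=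
      Finset.insert_subset_insert _ (Finset.sdiff_subset_sdiff hCP Finset.Subset.rfl)
    have hr'S : r' ∈ insert q (C \ Q) := (hrest q (Finset.mem_insert_self _ _)).left_mem
    have hrS : r ∈ insert q (P \ Q) :=
      Finset.mem_insert_of_mem (Finset.mem_sdiff.2 ⟨hr, fun h => hrC (hQC h)⟩)
    by_cases haC : a ∈ insert q (C \ Q)
    · exact (PathIn.of_adj (Finset.mem_coe.2 hrS) (Finset.mem_coe.2 (hsub hr'S)) hrr').trans
        ((hrest a haC).mono (Finset.coe_subset.2 hsub))
    · have haPC : a ∈ P \ C := by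
        rw [Finset.mem_insert, not_or, Finset.mem_sdiff] at haC
        rw [Finset.mem_insert, Finset.mem_sdiff] at ha
        rw [Finset.mem_sdiff]
        rcases ha with ha | ha
        · exact absurd ha haC.1
        · exact ⟨ha.1, fun h => haC.2 ⟨h, ha.2⟩⟩
      refine (hcompl a haPC).mono (Finset.coe_subset.2 fun b hb => Finset.mem_insert_of_mem ?_)
      rw [Finset.mem_sdiff] at hb ⊢
      exact ⟨hb.1, fun h => hb.2 (hQC h)⟩
  · -- Case B: the branch is small; split the rest and hang the branch onto `r`
    push Not at hA
    have hPC : P \ C ⊂ P := Finset.sdiff_ssubset hCP ⟨x, hxC⟩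
    have hcard : m ≤ (P \ C).card := by
      rw [Finset.card_sdiff_of_subset hCP]
      omega
    have hrPC : r ∈ P \ C := Finset.mem_sdiff.2 ⟨hr, hrC⟩
    obtain ⟨Q, hQ, q, hqQ, hQconn, hmQ, hQm, hrest⟩ := ih (P \ C) hPC r m hrPC hcompl hm hcard
    refine ⟨Q, hQ.trans Finset.sdiff_subset, q, hqQ, hQconn, hmQ, hQm, fun a ha => ?_⟩
    have hsub : insert q ((P \ C) \ Q) ⊆ insert q (P \ Q) :=
      Finset.insert_subset_insert _
        (Finset.sdiff_subset_sdiff Finset.sdiff_subset Finset.Subset.rfl)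
    by_cases ha' : a ∈ insert q ((P \ C) \ Q)
    · exact (hrest a ha').mono (Finset.coe_subset.2 hsub)
    · have haC : a ∈ C := by
        rw [Finset.mem_insert, not_or, Finset.mem_sdiff, Finset.mem_sdiff] at ha'
        rw [Finset.mem_insert, Finset.mem_sdiff] at ha
        rcases ha with ha | ha
        · exact absurd ha ha'.1
        · by_contra h
          exact ha'.2 ⟨⟨ha.1, h⟩, ha.2⟩
      have hrS : r ∈ insert q (P \ Q) := hsub (hrest q (Finset.mem_insert_self _ _)).left_mem
      have hCS : C ⊆ insert q (P \ Q) := fun b hb => Finset.mem_insert_of_mem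
        (Finset.mem_sdiff.2 ⟨hCP hb, fun h => (Finset.mem_sdiff.1 (hQ h)).2 hb⟩)
      exact (PathIn.of_adj (Finset.mem_coe.2 hrS) (Finset.mem_coe.2 (hCS hr'C)) hrr').trans
        ((hCconn a haC).mono (Finset.coe_subset.2 hCS))

/-- **Splitting lemma.** A finite set `P` connected through itself from `r ∈ P` with
`|P| ≥ 3m - 2`, `m ≥ 1`, contains `P₁, P₂ ⊆ P`, each connected through itself from a base point,
with `|P₁|, |P₂| ≥ m` and `|P₁ ∩ P₂| ≤ 1` (for the open graph: two edge-disjoint open trees with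
`≥ m` vertices inside one open piece). [cite: Hutchcroft2021, Lemma 2.4] -/
theorem exists_split (P : Finset V) (r : V) (m : ℕ) (hr : r ∈ P) (hP : ∀ a ∈ P, PathIn H ↑P r a)
    (hm : 1 ≤ m) (hmP : 3 * m - 2 ≤ P.card) :
    ∃ P₁ ⊆ P, ∃ P₂ ⊆ P, ∃ q₁ ∈ P₁, ∃ q₂ ∈ P₂, (∀ a ∈ P₁, PathIn H ↑P₁ q₁ a) ∧
      (∀ a ∈ P₂, PathIn H ↑P₂ q₂ a) ∧ m ≤ P₁.card ∧ m ≤ P₂.card ∧ (P₁ ∩ P₂).card ≤ 1 := by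
  obtain ⟨Q, hQP, q, hqQ, hQconn, hmQ, hQm, hrest⟩ :=
    exists_rooted_split P r m hr hP hm (by omega)
  refine ⟨Q, hQP, insert q (P \ Q), Finset.insert_subset (hQP hqQ) Finset.sdiff_subset, q, hqQ, r,
    (hrest q (Finset.mem_insert_self _ _)).left_mem, hQconn, hrest, hmQ, ?_, ?_⟩
  · have hQP' : Q.card ≤ P.card := Finset.card_le_card hQP
    rw [Finset.card_insert_of_notMem (fun h => (Finset.mem_sdiff.1 h).2 hqQ),
      Finset.card_sdiff_of_subset hQP]
    omega
  · have key : ∀ c ∈ Q ∩ insert q (P \ Q), c = q := fun c hc => by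
      rw [Finset.mem_inter, Finset.mem_insert, Finset.mem_sdiff] at hc
      exact hc.2.elim id fun h => absurd hc.1 h.2
    exact Finset.card_le_one.2 fun a ha b hb => by rw [key a ha, key b hb]

end Splitting

/-! ### §2 Size splitting of the largest piece of a finite vertex set under bond percolation -/

section Percolation

variable {V : Type*}

/-- The event "some `u ∈ B` is joined inside `B` by open paths to at least `t` vertices of `B`" is
increasing. [folklore] -/
theorem isUpperSet_largePiece (B : Finset V) (t : ℝ) :
    IsUpperSet {ω : BondConfig V | ∃ u ∈ B,
      t ≤ ((B.filter fun v => ω ∈ openConnIn ↑B u v).card : ℝ)} := by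
  rintro ω ω' hle ⟨u, hu, ht⟩
  refine ⟨u, hu, ht.trans ?_⟩
  exact_mod_cast Finset.card_le_card fun v hv => by
    rw [Finset.mem_filter] at hv ⊢
    exact ⟨hv.1, isUpperSet_openConnIn _ _ _ hle hv.2⟩

/-- The event "some `u ∈ B` is joined inside `B` by open paths to at least `t` vertices of `B`" is
finitary: it only reads the open pairs inside the finite set `B`. [folklore] -/
theorem isFinitary_largePiece (B : Finset V) (t : ℝ) :
    IsFinitary {ω : BondConfig V | ∃ u ∈ B,
      t ≤ ((B.filter fun v => ω ∈ openConnIn ↑B u v).card : ℝ)} := by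
  rintro ω ⟨u, hu, ht⟩
  have hK : ∀ v, ω ∈ openConnIn (↑B : Set V) u v ↔
      (↑(B.sym2.filter (· ∈ ω)) : Set (Sym2 V)) ∈ openConnIn (↑B : Set V) u v := by
    intro v
    refine (determinedBy_iff _ _).1 (DCT16.determinedBy_openConnIn (↑B : Set V) u v
      (K := (↑B.sym2 : Set (Sym2 V))) (by rw [Finset.coe_sym2])) ω _ ?_
    ext e
    simp only [Set.mem_inter_iff, Finset.coe_filter, Set.mem_setOf_eq, Finset.mem_coe]
    tauto
  refine ⟨B.sym2.filter (· ∈ ω), fun e he => ?_, u, hu, ?_⟩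
  · rw [Finset.coe_filter] at he
    exact he.2
  · rw [← Finset.filter_congr fun v _ => hK v]
    exact ht

/-- The two disjoint-occurrence witnesses: open non-loop pairs with both ends in `P₁`, resp. `P₂`,
are disjoint as soon as `|P₁ ∩ P₂| ≤ 1`. [folklore] -/
theorem disjoint_witnesses {P₁ P₂ : Finset V} (h : (P₁ ∩ P₂).card ≤ 1) (ω : BondConfig V) :
    Disjoint {e : Sym2 V | e ∈ ω ∧ ¬ e.IsDiag ∧ ∀ a ∈ e, a ∈ P₁}
      {e : Sym2 V | e ∈ ω ∧ ¬ e.IsDiag ∧ ∀ a ∈ e, a ∈ P₂} := by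
  rw [Set.disjoint_left]
  refine Sym2.ind fun a b => ?_
  rintro ⟨-, hdiag, h₁⟩ ⟨-, -, h₂⟩
  rw [Sym2.mk_isDiag_iff] at hdiag
  exact hdiag (Finset.card_le_one.1 h a
    (Finset.mem_inter.2 ⟨h₁ a (Sym2.mem_mk_left a b), h₂ a (Sym2.mem_mk_left a b)⟩) b
    (Finset.mem_inter.2 ⟨h₁ b (Sym2.mem_mk_right a b), h₂ b (Sym2.mem_mk_right a b)⟩))

/-- A witness occurs: under the configuration "open non-loop pairs of `ω` with both ends in `P₁`",
every vertex of a set `P₁ ⊆ B` that is connected through itself in the open graph of `ω` is still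
joined inside `B` to the base point, so the piece of the base point has `≥ |P₁| ≥ s` vertices.
[folklore] -/
theorem witness_mem_largePiece {B P₁ : Finset V} {ω : BondConfig V} {q : V} {s : ℝ}
    (hP₁B : P₁ ⊆ B) (hq : q ∈ P₁) (hconn : ∀ a ∈ P₁, PathIn (openGraph ω) ↑P₁ q a)
    (hs : s ≤ P₁.card) :
    {e : Sym2 V | e ∈ ω ∧ ¬ e.IsDiag ∧ ∀ a ∈ e, a ∈ P₁} ∈ {ω : BondConfig V | ∃ u ∈ B,
      s ≤ ((B.filter fun v => ω ∈ openConnIn ↑B u v).card : ℝ)} := by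
  have hsub : P₁ ⊆ B.filter fun v =>
      {e : Sym2 V | e ∈ ω ∧ ¬ e.IsDiag ∧ ∀ a ∈ e, a ∈ P₁} ∈ openConnIn ↑B q v := by
    intro v hv
    rw [Finset.mem_filter, DCT16.mem_openConnIn_iff_pathIn]
    refine ⟨hP₁B hv, (DCT16.pathIn_congrGraph (fun a b ha hb hab => ?_) (hconn v hv)).mono
      (Finset.coe_subset.2 hP₁B)⟩
    rw [openGraph_adj] at hab ⊢
    refine ⟨⟨hab.1, ?_, fun c hc => ?_⟩, hab.2⟩
    · rw [Sym2.mk_isDiag_iff]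
      exact hab.2
    · rcases Sym2.mem_iff.1 hc with rfl | rfl
      exacts [ha, hb]
  refine ⟨q, hP₁B hq, hs.trans ?_⟩
  exact_mod_cast Finset.card_le_card hsub

/-- **Deterministic size splitting** (Hutchcroft 2021, proof of Thm 2.3, `k = 1`): for `s ≥ 1`, if
some vertex of `B` is joined inside `B` to `≥ 3s` vertices, then the event "some vertex of `B` is
joined inside `B` to `≥ s` vertices" occurs disjointly twice. [cite: Hutchcroft2021, Thm 2.3] -/
theorem largePiece_three_subset_disjointOccurrence (B : Finset V) {s : ℝ} (hs : 1 ≤ s) :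
    {ω : BondConfig V | ∃ u ∈ B, 3 * s ≤ ((B.filter fun v => ω ∈ openConnIn ↑B u v).card : ℝ)} ⊆
      {ω : BondConfig V | ∃ u ∈ B, s ≤ ((B.filter fun v => ω ∈ openConnIn ↑B u v).card : ℝ)} □
      {ω : BondConfig V | ∃ u ∈ B, s ≤ ((B.filter fun v => ω ∈ openConnIn ↑B u v).card : ℝ)} := by
  rintro ω ⟨u, hu, h3s⟩
  obtain ⟨P, hP⟩ : ∃ P : Finset V, P = B.filter fun v => ω ∈ openConnIn ↑B u v := ⟨_, rfl⟩
  rw [← hP] at h3s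
  -- the integer threshold `m = ⌈s⌉ ≥ 1`, `s ≤ m < s + 1`, so the piece has `≥ 3m - 2` vertices
  have hm1 : 1 ≤ ⌈s⌉₊ := Nat.one_le_ceil_iff.2 (by linarith)
  have hsm : s ≤ (⌈s⌉₊ : ℝ) := Nat.le_ceil s
  have hcard : 3 * ⌈s⌉₊ - 2 ≤ P.card := by
    have hlt : (⌈s⌉₊ : ℝ) < s + 1 := Nat.ceil_lt_add_one (by linarith)
    have h3 : 3 * ⌈s⌉₊ < P.card + 3 := by
      exact_mod_cast (show ((3 * ⌈s⌉₊ : ℕ) : ℝ) < P.card + 3 by push_cast; linarith)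
    omega
  -- the piece `P` of `u` is connected through itself from `u` in the open graph
  have hmem : ∀ {v}, v ∈ P ↔ PathIn (openGraph ω) ↑B u v := fun {v} => by
    rw [hP, Finset.mem_filter, DCT16.mem_openConnIn_iff_pathIn, and_iff_right_iff_imp]
    exact fun h => h.right_mem
  have hPB : P ⊆ B := fun v hv => (hmem.1 hv).right_mem
  have hconn : ∀ a ∈ P, PathIn (openGraph ω) ↑P u a := fun a ha =>
    (pathIn_restrict (hmem.1 ha)).mono fun w hw => Finset.mem_coe.2 (hmem.2 hw.2)
  obtain ⟨P₁, hP₁, P₂, hP₂, q₁, hq₁, q₂, hq₂, hc₁, hc₂, hm₁, hm₂, hinter⟩ :=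
    exists_split P u ⌈s⌉₊ (hmem.2 (PathIn.refl (Finset.mem_coe.2 hu))) hconn hm1 hcard
  -- the witnesses: open non-loop pairs with both ends in `P₁`, resp. `P₂`
  rw [(isUpperSet_largePiece B s).mem_disjointOccurrence_iff (isUpperSet_largePiece B s)]
  exact ⟨{e | e ∈ ω ∧ ¬ e.IsDiag ∧ ∀ a ∈ e, a ∈ P₁}, fun e he => he.1,
    {e | e ∈ ω ∧ ¬ e.IsDiag ∧ ∀ a ∈ e, a ∈ P₂}, fun e he => he.1, disjoint_witnesses hinter ω,
    witness_mem_largePiece (hP₁.trans hPB) hq₁ hc₁ (hsm.trans (by exact_mod_cast hm₁)),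
    witness_mem_largePiece (hP₂.trans hPB) hq₂ hc₂ (hsm.trans (by exact_mod_cast hm₂))⟩

/-- **Size splitting under `P_p`** (Hutchcroft 2021, Thm 2.3 with `k = 1`, for the finite graph
induced on `B`; van den Berg–Kesten): for Bernoulli bond percolation on any graph with countably
many vertices, any finite vertex set `B` and any real `s ≥ 1`,
`P_p(∃ u ∈ B, |piece of u in B| ≥ 3s) ≤ P_p(∃ u ∈ B, |piece of u in B| ≥ s)²`.
[cite: Hutchcroft2021, Thm 2.3] -/
theorem real_largePiece_three_le_sq [Countable V] (G : SimpleGraph V) (p : unitInterval)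
    (B : Finset V) {s : ℝ} (hs : 1 ≤ s) :
    (bondPercolation G p).real
        {ω : BondConfig V | ∃ u ∈ B, 3 * s ≤ ((B.filter fun v => ω ∈ openConnIn ↑B u v).card : ℝ)}
      ≤ ((bondPercolation G p).real
        {ω : BondConfig V | ∃ u ∈ B,
          s ≤ ((B.filter fun v => ω ∈ openConnIn ↑B u v).card : ℝ)}) ^ 2 :=
  (measureReal_mono (largePiece_three_subset_disjointOccurrence B hs)).trans
    ((bk_finitary G p (isUpperSet_largePiece B s) (isUpperSet_largePiece B s)
      (isFinitary_largePiece B s) (isFinitary_largePiece B s)).trans_eq (sq _).symm)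

end Percolation

/-! ### §3 The registered stub -/

/-- **stub_sizeSplitting** (the lever of the line `tightness-collapse-typical-kmax`; van den
Berg–Kesten size splitting on the free box, Hutchcroft 2021 Thm 2.3 with `k = 1`). For bond
percolation on `ℤ³`, every `p`, every `n` and every real `s ≥ 1`:
`P_p(QG(n, 3s)) ≤ P_p(QG(n, s))²`, where `QG(n, t)` = "some vertex `u ∈ B(n) = box 3 n` is joined
inside `B(n)` by open paths to at least `t` vertices of `B(n)`". Degenerate parameters: `n = 0`
(`B(0) = {0}`, left side `0` since `3s ≥ 3 > 1`), `p ∈ {0, 1}` fine (the inequality is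
deterministic inclusion + BK). [cite: Hutchcroft2021, Thm 2.3] -/
theorem stub_sizeSplitting :
    ∀ (p : unitInterval) (n : ℕ) (s : ℝ), 1 ≤ s →
      (bondPercolation (zdGraph 3) p).real
          {ω | ∃ u ∈ box 3 n,
            3 * s ≤ (((box 3 n).filter fun v => ω ∈ openConnIn ↑(box 3 n) u v).card : ℝ)}
        ≤ ((bondPercolation (zdGraph 3) p).real
            {ω | ∃ u ∈ box 3 n,
              s ≤ (((box 3 n).filter fun v => ω ∈ openConnIn ↑(box 3 n) u v).card : ℝ)}) ^ 2 :=
  fun p n _ hs => real_largePiece_three_le_sq (zdGraph 3) p (box 3 n) hs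

end Summit.CriticalPhenomena.PercolationContinuityZ3.FreeBoxPowerSavingLine

end
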